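import Literature.AnabelianGeometry.SemiGraphs.TemperedBranchDouble
import HarnessLib

/-!
# The FOLD functor of the double of a semi-graph of anabelioids along a branch

Mochizuki, *Semi-graphs of anabelioids*, Publ. RIMS **42** (2006), §3, Prop. 3.2 p. 35, Def. 3.5 p. 37,
Prop. 3.6 (iv) p. 39, Thm. 3.7 (i)/(iii) pp. 40–41, Def. 3.8 / Cor. 3.9 p. 42
[cite: MochizukiSemiAnbd2006, Cor 3.9 p.42].

Toolkit of the abc-iut cell (layer L3, F wave seat abc-iut-f-175), sequel of `TemperedBranchDouble.lean`,
for the LITERAL reading of Def. 3.8 (cell finding t2g2-F1 / ruling χ2).  For `𝒢`, a vertex `w` and a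
branch `b` abutting to `w`, with `double` the double of `𝒢` along `b`:

* `ProfiniteSemiGraph.foldCov h : B^cov(𝒢) ⥤ B^cov(double)` — the FOLD functor
  `S ↦ (S_w, S_w, b^* S_w)` glued by identities (NOT the pull-back along a morphism of semi-graphs of
  anabelioids); it preserves finite limits and countable colimits (detected fibre by fibre,
  `CovObj.isLimitOfComponents`) and tempered objects (`foldBTemp`);
* through charts it is a morphism of connected temperoids (`foldTemperoidHom`), hence — Proposition 3.2,
  `TemperoidHomEqRes_holds` — represented by a continuous homomorphism
  `φ : π₁^temp(double) → π₁^temp(𝒢)` (`exists_foldHom`), which carries every verticial homomorphism of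
  the double to a verticial homomorphism of `𝒢` at `w` and every edge homomorphism to `ψ_w ∘ b_*`, up to
  conjugation (`fold_conj_verticial`, `fold_conj_edge`; Yoneda on Galois objects,
  `BTemp.exists_conj_of_natTrans`, exactly as for `Hom.conj_of_chartPullback_iso`).

Consumer: the refutation of the literal `Cor39` / `QuasiGeometricGraphData` (FACT-LIST row F-1710).
Nothing here takes a side on [IUTchIII] Cor. 3.12; no statement of the paper is asserted.
-/

noncomputable section

open CategoryTheory CategoryTheory.Limits Topology

namespace Literature.AnabelianGeometry.SemiGraphs

universe u

namespace ProfiniteSemiGraph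

variable {𝒢 : ProfiniteSemiGraph.{u}} {b : 𝒢.graph.Branch} {w : 𝒢.graph.Vertex}
  (h : 𝒢.graph.abuts b = some w)

/-! ### The fold functor `B^cov(𝒢) ⥤ B^cov(double)` -/

/-- The fold of an object of `B^cov(𝒢)`: `(S_w, S_w, b^* S_w)` glued by identities.
[cite: MochizukiSemiAnbd2006, Def 3.5(i) p.37] -/
def foldObj (S : CovObj 𝒢) : CovObj (𝒢.double h) where
  SV _ := S.SV w
  SE _ := (BTemp.res (𝒢.brHom b w h)).obj (S.SV w)
  glue _ _ _ := Iso.refl _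

/-- The fold of a morphism of `B^cov(𝒢)`: its `w`-component everywhere.
[cite: MochizukiSemiAnbd2006, §3 p.36] -/
def foldMap {S T : CovObj 𝒢} (f : S ⟶ T) : foldObj h S ⟶ foldObj h T where
  fV _ := f.fV w
  fE _ := (BTemp.res (𝒢.brHom b w h)).map (f.fV w)
  comm _ _ _ := by
    change _ ≫ 𝟙 _ = 𝟙 _ ≫ _
    rw [Category.comp_id, Category.id_comp]
    rfl

/-- **The FOLD functor** `B^cov(𝒢) ⥤ B^cov(double)`, `S ↦ (S_w, S_w, b^* S_w)` (finding t2g2-F1: the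
functor whose representing homomorphism folds `π₁^temp(double)` onto the verticial subgroup of `w`).
[cite: MochizukiSemiAnbd2006, Def 3.8 p.42] -/
def foldCov : CovObj 𝒢 ⥤ CovObj (𝒢.double h) where
  obj := foldObj h
  map := foldMap h
  map_id S := by
    refine CovHom.ext ?_ ?_ <;> funext _
    · rfl
    · exact (BTemp.res _).map_id _
  map_comp f g := by
    refine CovHom.ext ?_ ?_ <;> funext _
    · rfl
    · exact (BTemp.res _).map_comp _ _

/-- Fold then restrict to a vertex = restrict to `w` (definitional). [cite: MochizukiSemiAnbd2006, Def 3.5(ii) p.37] -/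
theorem foldCov_comp_restrictV (v : (𝒢.double h).graph.Vertex) :
    foldCov h ⋙ restrictV (𝒢.double h) v = restrictV 𝒢 w := rfl

/-- Fold then restrict to the edge = restrict to `w` then `B^temp(b_*)` (definitional).
[cite: MochizukiSemiAnbd2006, Def 3.5(ii) p.37] -/
theorem foldCov_comp_restrictE (e : (𝒢.double h).graph.Edge) :
    foldCov h ⋙ restrictE (𝒢.double h) e = restrictV 𝒢 w ⋙ BTemp.res (𝒢.brHom b w h) := rfl

/-- The fold functor preserves finite limits (detected fibre by fibre).
[cite: MochizukiSemiAnbd2006, Prop 3.6(iv) p.39] -/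
theorem preservesLimitsOfShape_foldCov (J : Type) [SmallCategory J] [FinCategory J] :
    PreservesLimitsOfShape J (foldCov h) := by
  haveI : PreservesLimitsOfShape J (restrictV 𝒢 w) := CovObj.preservesLimitsOfShape_restrictV 𝒢 w
  haveI : PreservesLimitsOfShape J (BTemp.res (𝒢.brHom b w h)) :=
    btempRes_preservesLimitsOfShape (𝒢.brHom b w h) J
  refine ⟨fun {K} => ⟨fun {c} hc => CovObj.isLimitOfComponents _ (fun v => ?_) (fun e => ?_)⟩⟩
  · change IsLimit ((foldCov h ⋙ restrictV (𝒢.double h) v).mapCone c)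
    rw [foldCov_comp_restrictV h v]
    exact isLimitOfPreserves _ hc
  · change IsLimit ((foldCov h ⋙ restrictE (𝒢.double h) e).mapCone c)
    rw [foldCov_comp_restrictE h e]
    exact isLimitOfPreserves _ hc

/-- The fold functor preserves countable colimits (detected fibre by fibre).
[cite: MochizukiSemiAnbd2006, Prop 3.6(iv) p.39] -/
theorem preservesColimitsOfShape_foldCov (J : Type) [SmallCategory J] [CountableCategory J] :
    PreservesColimitsOfShape J (foldCov h) := by
  haveI : PreservesColimitsOfShape J (restrictV 𝒢 w) := CovObj.preservesColimitsOfShape_restrictV 𝒢 w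
  haveI : PreservesColimitsOfShape J (BTemp.res (𝒢.brHom b w h)) :=
    btempRes_preservesColimitsOfShape (𝒢.brHom b w h) J
  refine ⟨fun {K} => ⟨fun {c} hc => CovObj.isColimitOfComponents _ (fun v => ?_) (fun e => ?_)⟩⟩
  · change IsColimit ((foldCov h ⋙ restrictV (𝒢.double h) v).mapCocone c)
    rw [foldCov_comp_restrictV h v]
    exact isColimitOfPreserves _ hc
  · change IsColimit ((foldCov h ⋙ restrictE (𝒢.double h) e).mapCocone c)
    rw [foldCov_comp_restrictE h e]
    exact isColimitOfPreserves _ hc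

/-! ### The fold preserves tempered objects -/

/-- Every point of the fold of `S` lies over a point of `S_w`. [cite: MochizukiSemiAnbd2006, Def 3.5(ii) p.37] -/
def foldPointMap (S : CovObj 𝒢) : ((foldCov h).obj S).Point → S.Point
  | Sum.inl ⟨_, x⟩ => Sum.inl ⟨w, x⟩
  | Sum.inr ⟨_, x⟩ => Sum.inl ⟨w, x⟩

/-- Points of the fold in one connected component lie over points of `S` in one connected component.
[cite: MochizukiSemiAnbd2006, Def 3.5(ii) p.37] -/
theorem sameComponent_foldPointMap (S : CovObj 𝒢) {p q : ((foldCov h).obj S).Point}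
    (hpq : ((foldCov h).obj S).SameComponent p q) :
    S.SameComponent (foldPointMap h S p) (foldPointMap h S q) := by
  induction hpq with
  | rel a c hac =>
    cases hac with
    | vertex v g x => exact Relation.EqvGen.rel _ _ (CovObj.Adj.vertex w g x)
    | edge e g x => exact Relation.EqvGen.rel _ _ (CovObj.Adj.vertex w (𝒢.brHom b w h g) x)
    | glue β v hv x => exact Relation.EqvGen.refl _
  | refl a => exact Relation.EqvGen.refl _
  | symm a c _ ih => exact Relation.EqvGen.symm _ _ ih
  | trans a c d _ _ ih₁ ih₂ => exact Relation.EqvGen.trans _ _ _ ih₁ ih₂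

/-- The fold of a finite object is finite. [cite: MochizukiSemiAnbd2006, §3 p.37] -/
theorem isFinite_foldCov {T : CovObj 𝒢} (hT : T.IsFinite) : ((foldCov h).obj T).IsFinite :=
  ⟨fun _ => hT.finite_V w, fun _ => hT.finite_V w⟩

/-- The fold of an object with nonempty fibres has nonempty fibres. [cite: MochizukiSemiAnbd2006, §3 p.37] -/
theorem hasNonemptyFibres_foldCov {T : CovObj 𝒢} (hT : T.HasNonemptyFibres) :
    ((foldCov h).obj T).HasNonemptyFibres :=
  ⟨fun _ => hT.nonempty_V w, fun _ => hT.nonempty_V w⟩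

/-- Splitting is preserved by the fold. [cite: MochizukiSemiAnbd2006, Def 3.5(ii) p.37] -/
theorem splitsAt_foldCov {T S : CovObj 𝒢} {q : ((foldCov h).obj S).Point}
    (hq : T.SplitsAt S (foldPointMap h S q)) : ((foldCov h).obj T).SplitsAt ((foldCov h).obj S) q := by
  rcases q with ⟨v, s⟩ | ⟨e, s⟩
  · exact fun x g hx => hq x g hx
  · exact fun x g hx => hq x (𝒢.brHom b w h g) hx

/-- **The fold preserves tempered objects** (Def. 3.5 (ii)). [cite: MochizukiSemiAnbd2006, Def 3.5(ii) p.37] -/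
theorem isTempered_foldCov {S : CovObj 𝒢} (hS : S.IsTempered) : ((foldCov h).obj S).IsTempered := by
  intro p
  obtain ⟨T, hTfin, hTne, hsplit⟩ := hS (foldPointMap h S p)
  exact ⟨(foldCov h).obj T, isFinite_foldCov h hTfin, hasNonemptyFibres_foldCov h hTne,
    fun q hpq => splitsAt_foldCov h (hsplit _ (sameComponent_foldPointMap h S hpq))⟩

/-- The fold functor on tempered objects `B^temp(𝒢) ⥤ B^temp(double)`.
[cite: MochizukiSemiAnbd2006, Def 3.5(ii) p.37] -/
def foldBTemp : BTempCat 𝒢 ⥤ BTempCat (𝒢.double h) :=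
  ObjectProperty.lift _ (ObjectProperty.ι _ ⋙ foldCov h) fun S => isTempered_foldCov h S.property

/-- `foldBTemp` lies over `foldCov` (definitional). [cite: MochizukiSemiAnbd2006, Def 3.5(ii) p.37] -/
theorem foldBTemp_comp_ι : foldBTemp h ⋙ ObjectProperty.ι _ = ObjectProperty.ι _ ⋙ foldCov h := rfl

/-- `foldBTemp` preserves finite limits. [cite: MochizukiSemiAnbd2006, Prop 3.6(iv) p.39] -/
theorem preservesLimitsOfShape_foldBTemp (J : Type) [SmallCategory J] [FinCategory J] :
    PreservesLimitsOfShape J (foldBTemp h) := by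
  haveI := isTempered_isClosedUnderLimitsOfShape (𝒢 := 𝒢) J
  haveI := isTempered_isClosedUnderLimitsOfShape (𝒢 := 𝒢.double h) J
  haveI := CovObj.hasLimitsOfShape (𝒢 := 𝒢) (J := J)
  haveI := CovObj.hasLimitsOfShape (𝒢 := 𝒢.double h) (J := J)
  haveI := preservesLimitsOfShape_foldCov h J
  haveI : PreservesLimitsOfShape J (foldBTemp h ⋙ ObjectProperty.ι _) := by
    rw [foldBTemp_comp_ι]
    infer_instance
  exact preservesLimitsOfShape_of_reflects_of_preserves (foldBTemp h) (ObjectProperty.ι _)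

/-- `foldBTemp` preserves countable colimits. [cite: MochizukiSemiAnbd2006, Prop 3.6(iv) p.39] -/
theorem preservesColimitsOfShape_foldBTemp (J : Type) [SmallCategory J] [CountableCategory J] :
    PreservesColimitsOfShape J (foldBTemp h) := by
  haveI := isTempered_isClosedUnderColimitsOfShape (𝒢 := 𝒢) J
  haveI := isTempered_isClosedUnderColimitsOfShape (𝒢 := 𝒢.double h) J
  haveI := CovObj.hasColimitsOfShape (𝒢 := 𝒢) (J := J)
  haveI := CovObj.hasColimitsOfShape (𝒢 := 𝒢.double h) (J := J)
  haveI := preservesColimitsOfShape_foldCov h J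
  haveI : PreservesColimitsOfShape J (foldBTemp h ⋙ ObjectProperty.ι _) := by
    rw [foldBTemp_comp_ι]
    infer_instance
  exact preservesColimitsOfShape_of_reflects_of_preserves (foldBTemp h) (ObjectProperty.ι _)

/-! ### Through charts: a morphism of connected temperoids and its representing homomorphism -/

/-- The fold through charts: `B^temp(π₁^temp 𝒢) ⥤ B^temp(π₁^temp double)`, `c⁻¹ ⋙ fold ⋙ c_D`.
[cite: MochizukiSemiAnbd2006, Prop 3.2 p.35] -/
def foldChartPullback (cD : TemperedPiChart (𝒢.double h)) (c : TemperedPiChart 𝒢) :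
    BTemp c.G ⥤ BTemp cD.G :=
  c.equiv.inverse ⋙ foldBTemp h ⋙ cD.equiv.functor

/-- The fold is a morphism of connected temperoids `B^temp(π₁^temp double) → B^temp(π₁^temp 𝒢)`
(Definition 3.1 (iii)). [cite: MochizukiSemiAnbd2006, Def 3.1(iii) p.33] -/
def foldTemperoidHom (cD : TemperedPiChart (𝒢.double h)) (c : TemperedPiChart 𝒢) :
    TemperoidHom (BTemp cD.G) (BTemp c.G) where
  pullback := foldChartPullback h cD c
  preservesFiniteLimits := ⟨fun J _ _ => by
    haveI := preservesLimitsOfShape_foldBTemp h J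
    unfold foldChartPullback
    infer_instance⟩
  preservesCountableColimits J _ _ := by
    haveI := preservesColimitsOfShape_foldBTemp h J
    unfold foldChartPullback
    infer_instance

/-- **The fold homomorphism exists** (Proposition 3.2, `TemperoidHomEqRes_holds`): a continuous
`φ : π₁^temp(double) → π₁^temp(𝒢)` with `B^temp(φ) ≅ c⁻¹ ⋙ fold ⋙ c_D`.
[cite: MochizukiSemiAnbd2006, Prop 3.2 p.35] -/
theorem exists_foldHom (cD : TemperedPiChart (𝒢.double h)) (c : TemperedPiChart 𝒢) :
    ∃ φ : cD.G →ₜ* c.G, Nonempty (foldChartPullback h cD c ≅ BTemp.res φ) := by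
  haveI := cD.secondCountableTopology
  haveI := c.secondCountableTopology
  exact TemperoidHomEqRes_holds cD.G c.G cD.isTempered c.isTempered (foldTemperoidHom h cD c)

/-- **The fold carries verticial homomorphisms to verticial homomorphisms at `w`**: if `φ` represents
the fold, then for every verticial homomorphism `ψ'` of the double (at either vertex) and every
verticial homomorphism `ψ` of `𝒢` at `w`, `φ ∘ ψ'` and `ψ` are conjugate in `π₁^temp(𝒢)` — so `φ`
maps every verticial subgroup of the double ONTO a verticial subgroup of `𝒢` at `w`.
[cite: MochizukiSemiAnbd2006, Thm 3.7(i) p.40] -/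
theorem fold_conj_verticial (cD : TemperedPiChart (𝒢.double h)) (c : TemperedPiChart 𝒢)
    (φ : cD.G →ₜ* c.G) (hφ : Nonempty (foldChartPullback h cD c ≅ BTemp.res φ))
    (v : (𝒢.double h).graph.Vertex) (ψ' : (𝒢.double h).Gv v →ₜ* cD.G) (ψ : 𝒢.Gv w →ₜ* c.G)
    (hψ' : IsVerticialHom cD v ψ') (hψ : IsVerticialHom c w ψ) :
    ∃ g : c.G, ∀ x, φ (ψ' x) = g * ψ x * g⁻¹ := by
  obtain ⟨e⟩ := hφ
  obtain ⟨e'⟩ := hψ'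
  obtain ⟨eψ⟩ := hψ
  let s3 : (c.equiv.inverse ⋙ foldBTemp h) ⋙ (cD.equiv.functor ⋙ BTemp.res ψ') ≅
      (c.equiv.inverse ⋙ foldBTemp h) ⋙
        (cD.equiv.functor ⋙ (cD.equiv.inverse ⋙ ObjectProperty.ι _ ⋙ restrictV (𝒢.double h) v)) :=
    Functor.isoWhiskerLeft _ (Functor.isoWhiskerLeft _ e'.symm)
  let s4 : (c.equiv.inverse ⋙ foldBTemp h) ⋙
        (cD.equiv.functor ⋙ (cD.equiv.inverse ⋙ ObjectProperty.ι _ ⋙ restrictV (𝒢.double h) v)) ≅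
      (c.equiv.inverse ⋙ foldBTemp h) ⋙ (ObjectProperty.ι _ ⋙ restrictV (𝒢.double h) v) :=
    Functor.isoWhiskerLeft _ ((Functor.associator _ _ _).symm ≪≫
      Functor.isoWhiskerRight cD.equiv.unitIso.symm _ ≪≫ Functor.leftUnitor _)
  let s5 : (c.equiv.inverse ⋙ foldBTemp h) ⋙ (ObjectProperty.ι _ ⋙ restrictV (𝒢.double h) v) ≅
      c.equiv.inverse ⋙ ObjectProperty.ι _ ⋙ restrictV 𝒢 w :=
    Iso.refl _
  let η : BTemp.res (φ.comp ψ') ≅ BTemp.res ψ :=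
    (BTemp.resComp φ ψ').symm ≪≫ Functor.isoWhiskerRight e.symm (BTemp.res ψ') ≪≫ s3 ≪≫ s4 ≪≫ s5 ≪≫ eψ
  obtain ⟨g, hg, -⟩ := BTemp.exists_conj_of_natTrans c.isTempered (φ.comp ψ') ψ η.hom
  refine ⟨g⁻¹, fun x => ?_⟩
  have hx := hg x
  change g * φ (ψ' x) * g⁻¹ = ψ x at hx
  rw [← hx]
  group

/-- **The fold carries edge homomorphisms to `ψ_w ∘ b_*`**: if `φ` represents the fold, then for every
edge homomorphism `ψ'` of the double and every verticial homomorphism `ψ` of `𝒢` at `w`, `φ ∘ ψ'` and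
`ψ ∘ b_*` are conjugate in `π₁^temp(𝒢)` — so `φ` maps the edge-like subgroups of the double ONTO
conjugates of `ψ(Π_b)`, i.e. (by the chart's gluing) onto edge-like subgroups of `𝒢` at the edge of `b`.
[cite: MochizukiSemiAnbd2006, Thm 3.7(iii) p.41] -/
theorem fold_conj_edge (cD : TemperedPiChart (𝒢.double h)) (c : TemperedPiChart 𝒢)
    (φ : cD.G →ₜ* c.G) (hφ : Nonempty (foldChartPullback h cD c ≅ BTemp.res φ))
    (e : (𝒢.double h).graph.Edge) (ψ' : (𝒢.double h).Ge e →ₜ* cD.G) (ψ : 𝒢.Gv w →ₜ* c.G)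
    (hψ' : IsEdgeHom cD e ψ') (hψ : IsVerticialHom c w ψ) :
    ∃ g : c.G, ∀ x, φ (ψ' x) = g * ψ (𝒢.brHom b w h x) * g⁻¹ := by
  obtain ⟨e₀⟩ := hφ
  obtain ⟨e'⟩ := hψ'
  obtain ⟨eψ⟩ := hψ
  let s3 : (c.equiv.inverse ⋙ foldBTemp h) ⋙ (cD.equiv.functor ⋙ BTemp.res ψ') ≅
      (c.equiv.inverse ⋙ foldBTemp h) ⋙
        (cD.equiv.functor ⋙ (cD.equiv.inverse ⋙ ObjectProperty.ι _ ⋙ restrictE (𝒢.double h) e)) :=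
    Functor.isoWhiskerLeft _ (Functor.isoWhiskerLeft _ e'.symm)
  let s4 : (c.equiv.inverse ⋙ foldBTemp h) ⋙
        (cD.equiv.functor ⋙ (cD.equiv.inverse ⋙ ObjectProperty.ι _ ⋙ restrictE (𝒢.double h) e)) ≅
      (c.equiv.inverse ⋙ foldBTemp h) ⋙ (ObjectProperty.ι _ ⋙ restrictE (𝒢.double h) e) :=
    Functor.isoWhiskerLeft _ ((Functor.associator _ _ _).symm ≪≫
      Functor.isoWhiskerRight cD.equiv.unitIso.symm _ ≪≫ Functor.leftUnitor _)
  let s5 : (c.equiv.inverse ⋙ foldBTemp h) ⋙ (ObjectProperty.ι _ ⋙ restrictE (𝒢.double h) e) ≅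
      (c.equiv.inverse ⋙ ObjectProperty.ι _ ⋙ restrictV 𝒢 w) ⋙ BTemp.res (𝒢.brHom b w h) :=
    Iso.refl _
  let η : BTemp.res (φ.comp ψ') ≅ BTemp.res (ψ.comp (𝒢.brHom b w h)) :=
    (BTemp.resComp φ ψ').symm ≪≫ Functor.isoWhiskerRight e₀.symm (BTemp.res ψ') ≪≫ s3 ≪≫ s4 ≪≫ s5 ≪≫
      Functor.isoWhiskerRight eψ (BTemp.res (𝒢.brHom b w h)) ≪≫ BTemp.resComp ψ (𝒢.brHom b w h)
  obtain ⟨g, hg, -⟩ :=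
    BTemp.exists_conj_of_natTrans c.isTempered (φ.comp ψ') (ψ.comp (𝒢.brHom b w h)) η.hom
  refine ⟨g⁻¹, fun x => ?_⟩
  have hx := hg x
  change g * φ (ψ' x) * g⁻¹ = ψ (𝒢.brHom b w h x) at hx
  rw [← hx]
  group

end ProfiniteSemiGraph

end Literature.AnabelianGeometry.SemiGraphs

end
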